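import Mathlib
import HarnessLib
import Summits.ValiantsHypothesis.ValiantsHypothesis.Theses.MonotoneRestoration
import Literature.Computability.AlgebraicComplexity.ArithCircuit
import Literature.Computability.AlgebraicComplexity.ArithCircuitProofs
import Literature.Computability.AlgebraicComplexity.MonotoneStructure
import Literature.Computability.AlgebraicComplexity.PermanentIrreducible
import Literature.ModelTheory.FiniteModelTheory.CkEquiv
import Summits.ValiantsHypothesis.ValiantsHypothesis.Theorems.MonotoneRestorationMonotoneRestorationQPCosetCount
import Summits.ValiantsHypothesis.ValiantsHypothesis.Theorems.MonotoneRestorationMonotoneRestorationQPSymmetricLB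
import Summits.ValiantsHypothesis.ValiantsHypothesis.Theorems.MonotoneRestorationMonotoneRestorationQPSupportSymmetrisation
import Summits.ValiantsHypothesis.ValiantsHypothesis.Theorems.MonotoneRestorationMonotoneRestorationQPSparseRegime
import Summits.ValiantsHypothesis.ValiantsHypothesis.Theorems.MonotoneRestorationMonotoneRestorationQPBeta
import Literature.Computability.AlgebraicComplexity.SymmetricArithCircuit
import Literature.Computability.AlgebraicComplexity.DawarWilsenach2025Proofs
import Literature.GroupTheory.PermutationGroups.SmallIndexSubgroups
import Summits.ValiantsHypothesis.ValiantsHypothesis.Theorems.MonotoneRestorationQP.Negative.LoadBearing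
import Summits.ValiantsHypothesis.ValiantsHypothesis.Theorems.MonotoneRestorationMonotoneRestorationQPPermSupportCount

/-! TTRL-lite variant V20093 of stmt-ValiantsHypothesis-15886

Variant `lemma_proposal` of stub `stub_gateSupport` (line c2 of crux `MonotoneRestorationQP`): for a
labelled arithmetic circuit `C` on the `n × n` variable matrix, the extension relation
`{(ρ, π) | π is an automorphism of C extending ρ}` is (the carrier of) a subgroup of
`Sym_n × Sym(G)`.  This is the structural object behind the support argument (the permutations
admitting an extension fixing a gate `g` are the first projection of the stabiliser of `g`).

Proof: the identity pair is an automorphism (`isAutomorphismExtending_one`), inverses of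
automorphisms are automorphisms (`IsAutomorphismExtending.inv`), and automorphisms compose with
the orders matched, `(ρ₁ρ₂, π₁π₂)` from `h₂.trans h₁` (`IsAutomorphismExtending.trans`).
-/

-- `Summit.ValiantsHypothesis.ValiantsHypothesis.…` is the tree's mandated single-conjunct layout
-- (Sub = Summit), so the duplicated namespace component is intended.
set_option linter.dupNamespace false

namespace Summit.ValiantsHypothesis.ValiantsHypothesis.Theorems

open Summit.ValiantsHypothesis.ValiantsHypothesis.Theses.MonotoneRestoration
open Literature.Computability.AlgebraicComplexity

/-- **TTRL-lite variant V20093 of `stub_gateSupport`.** For every labelled arithmetic circuit `C`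
over the `n × n` variable matrix there is a subgroup `A ≤ Sym_n × Sym(G)` whose members are exactly
the pairs `(ρ, π)` such that `π` is a circuit automorphism of `C` extending `ρ`: the extension
relation contains `(1, 1)`, is closed under inverses and under componentwise products.
[cite: DawarWilsenach2025, Def. 3.6] -/
theorem stub_gateSupport_var20093 :
    ∀ (n : ℕ) (K : Type) (G : Type) (C : LabelledArithCircuit K (Fin n × Fin n) Unit G),
      ∃ A : Subgroup (Equiv.Perm (Fin n) × Equiv.Perm G),
        ∀ (ρ : Equiv.Perm (Fin n)) (π : Equiv.Perm G),
          (ρ, π) ∈ A ↔ C.IsAutomorphismExtending ρ π := by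
  intro n K G C
  refine ⟨{ carrier := {a | C.IsAutomorphismExtending a.1 a.2}
            mul_mem' := ?_
            one_mem' := C.isAutomorphismExtending_one
            inv_mem' := ?_ }, fun ρ π => Iff.rfl⟩
  · rintro ⟨ρ₁, π₁⟩ ⟨ρ₂, π₂⟩ h₁ h₂
    exact h₂.trans h₁
  · rintro ⟨ρ, π⟩ h
    exact h.inv

end Summit.ValiantsHypothesis.ValiantsHypothesis.Theorems
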